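import Mathlib
import Summits.AtomisticToContinuum.Crystallization.Theorems.BraggSlacknessRigiditySlacknessTransferFourier

/-!
# Gaussian identities for the dense-centres stub of `HcpDiffractionRigidity`
# (item `stmt-AtomisticToContinuum-13166`, stub `stub_denseCentres`, Aux file 1)

Closed Gaussian integrals on `ℝ³` (all from Mathlib's
`GaussianFourier.integral_cexp_neg_mul_sq_norm_add`):

* `integral_rexp_neg_mul_sq_norm_add_inner` — `∫ e^{-B|v|² + c⟨w,v⟩} dv = (π/B)^{3/2} e^{c²|w|²/(4B)}`;
* `integral_gauss_mul_gauss` — the product of two Gaussians integrates to a Gaussian of the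
  difference of the centres;
* `integral_gauss_phase` — `∫ e^{-σ|ξ|²} e^{2πi⟨ξ,u-v⟩} dξ = (π/σ)^{3/2} e^{-π²|u-v|²/σ}`;
* `integral_normSq_gaussSum` — the Gaussian-weighted quadratic-form identity
  `∫ |∑ᵢ cᵢ e^{-σᵢ|ξ|²} e^{2πi⟨ξ,yᵢ⟩}|² dξ = ∑ᵢ∑ⱼ cᵢcⱼ (π/(σᵢ+σⱼ))^{3/2} e^{-π²|yᵢ-yⱼ|²/(σᵢ+σⱼ)}`;
* `integral_sq_gaussSum` — `∫ (∑ᵢ cᵢ e^{-pᵢ|z-yᵢ|²})² dz` as the same kind of double sum;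
* `integral_sq_gaussSum_eq_integral_normSq` — the resulting Plancherel-type identity
  `∫ (∑ᵢ cᵢ e^{-π|z-yᵢ|²/sᵢ²})² dz = ∫ |∑ᵢ cᵢ sᵢ³ e^{-π sᵢ²|ξ|²} e^{2πi⟨ξ,yᵢ⟩}|² dξ`;
* the two-scale kernel `ψ = G_a − (a/b)³ G_b` (`G_s(v) = e^{-π|v|²/s²}`): its spatial sum
  `F(z) = ∑ₖ ψ(z - yₖ)`, its Fourier profile `t = a³(e^{-πa²|ξ|²} − e^{-πb²|ξ|²})`,
  the identity `∫ F² = ∫ t² |S_N|²` (`integral_kernelSum_sq`) and the splitting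
  `∫ t²|S_N|² ≤ ∫ h|S_N|² + c₁ ∫ e^{-π|ξ|²}|S_N|² + c₂ ∫ e^{-πa²|ξ|²}|S_N|²` under a pointwise bound
  `t² ≤ h + c₁ e^{-π|ξ|²} + c₂ e^{-πa²|ξ|²}` (`integral_tprof_sf_le`).

All `[folklore]`.
-/

noncomputable section

namespace Summit.AtomisticToContinuum.Crystallization.Theorems

namespace HcpRigidityDenseCentres

open MeasureTheory Complex
open scoped BigOperators Real RealInnerProductSpace ComplexConjugate
open Summit.AtomisticToContinuum.Crystallization.Theorems.BraggSlacknessTransfer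

/-! ## Scalar Gaussian integrals -/

/-- The Gaussian constant `(π/B)^{3/2}` as a complex power equals the real power. [folklore] -/
theorem gaussConst_eq {B : ℝ} (hB : 0 < B) :
    ((Real.pi : ℂ) / (B : ℂ)) ^ ((Module.finrank ℝ (EuclideanSpace ℝ (Fin 3)) : ℂ) / 2) =
      (((Real.pi / B) ^ ((3 : ℝ) / 2) : ℝ) : ℂ) := by
  rw [finrank_euclideanSpace_fin, Complex.ofReal_cpow (by positivity)]
  push_cast
  norm_num

/-- `∫ e^{-B|v|² + c⟨w,v⟩} dv = (π/B)^{3/2} e^{c²|w|²/(4B)}` on `ℝ³` (real form). [folklore] -/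
theorem integral_rexp_neg_mul_sq_norm_add_inner {B : ℝ} (hB : 0 < B) (c : ℝ) (w : EuclideanSpace ℝ (Fin 3)) :
    ∫ v : EuclideanSpace ℝ (Fin 3), Real.exp (-B * ‖v‖ ^ 2 + c * ⟪w, v⟫) =
      (Real.pi / B) ^ ((3 : ℝ) / 2) * Real.exp (c ^ 2 * ‖w‖ ^ 2 / (4 * B)) := by
  have h := GaussianFourier.integral_cexp_neg_mul_sq_norm_add (V := EuclideanSpace ℝ (Fin 3)) (b := (B : ℂ))
    (by simpa using hB) (c : ℂ) w
  rw [gaussConst_eq hB] at h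
  apply Complex.ofReal_injective
  rw [← integral_complex_ofReal]
  push_cast
  convert h using 1

/-- Real Gaussians are integrable on `ℝ³`. [folklore] -/
theorem integrable_rexp_neg_mul_sq_norm {b : ℝ} (hb : 0 < b) :
    Integrable (fun v : EuclideanSpace ℝ (Fin 3) => Real.exp (-b * ‖v‖ ^ 2)) := by
  by_contra h
  have h1 := GaussianFourier.integral_rexp_neg_mul_sq_norm (V := EuclideanSpace ℝ (Fin 3)) hb
  rw [integral_undef h] at h1
  have h2 : (0 : ℝ) < (Real.pi / b) ^ ((Module.finrank ℝ (EuclideanSpace ℝ (Fin 3)) : ℝ) / 2) := by positivity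
  linarith

/-- Translated real Gaussians are integrable on `ℝ³`. [folklore] -/
theorem integrable_rexp_neg_mul_sq_norm_sub {b : ℝ} (hb : 0 < b) (u : EuclideanSpace ℝ (Fin 3)) :
    Integrable (fun v : EuclideanSpace ℝ (Fin 3) => Real.exp (-b * ‖v - u‖ ^ 2)) :=
  (integrable_rexp_neg_mul_sq_norm hb).comp_sub_right u

/-- The product of two (translated) Gaussians is integrable. [folklore] -/
theorem integrable_gauss_mul_gauss {p q : ℝ} (hp : 0 < p) (hq : 0 < q) (u v : EuclideanSpace ℝ (Fin 3)) :
    Integrable (fun z : EuclideanSpace ℝ (Fin 3) => Real.exp (-p * ‖z - u‖ ^ 2) * Real.exp (-q * ‖z - v‖ ^ 2)) := by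
  refine (integrable_rexp_neg_mul_sq_norm_sub hp u).mul_bdd (c := 1) ?_ (ae_of_all _ fun z => ?_)
  · exact Continuous.aestronglyMeasurable (by fun_prop)
  · rw [Real.norm_eq_abs, abs_of_nonneg (Real.exp_pos _).le, Real.exp_le_one_iff]
    nlinarith [sq_nonneg ‖z - v‖]

/-- **Product of two Gaussians.** `∫ e^{-p|z-u|²} e^{-q|z-v|²} dz =
(π/(p+q))^{3/2} e^{-(pq/(p+q))|u-v|²}`. [folklore] -/
theorem integral_gauss_mul_gauss {p q : ℝ} (hp : 0 < p) (hq : 0 < q) (u v : EuclideanSpace ℝ (Fin 3)) :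
    ∫ z : EuclideanSpace ℝ (Fin 3), Real.exp (-p * ‖z - u‖ ^ 2) * Real.exp (-q * ‖z - v‖ ^ 2) =
      (Real.pi / (p + q)) ^ ((3 : ℝ) / 2) * Real.exp (-(p * q / (p + q)) * ‖u - v‖ ^ 2) := by
  have hpq : 0 < p + q := add_pos hp hq
  set d : EuclideanSpace ℝ (Fin 3) := v - u with hd
  have key : ∀ z : EuclideanSpace ℝ (Fin 3), Real.exp (-p * ‖z + u - u‖ ^ 2) * Real.exp (-q * ‖z + u - v‖ ^ 2) =
      Real.exp (-(p + q) * ‖z‖ ^ 2 + (2 * q) * ⟪d, z⟫) * Real.exp (-q * ‖d‖ ^ 2) := by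
    intro z
    rw [← Real.exp_add, ← Real.exp_add]
    congr 1
    have h1 : z + u - u = z := by abel
    have h2 : z + u - v = z - d := by rw [hd]; abel
    rw [h1, h2, norm_sub_sq_real, real_inner_comm]
    ring
  rw [← integral_add_right_eq_self _ u]
  simp_rw [key]
  rw [integral_mul_const, integral_rexp_neg_mul_sq_norm_add_inner hpq, mul_assoc, ← Real.exp_add]
  congr 2
  rw [hd, norm_sub_rev]
  field_simp
  ring

/-! ## Gaussian Fourier pairing with the structure-factor phases -/

/-- The phase-weighted Gaussian as one complex exponential. [folklore] -/
theorem gauss_phase_eq {σ : ℝ} (ξ u v : EuclideanSpace ℝ (Fin 3)) :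
    (Real.exp (-σ * ‖ξ‖ ^ 2) : ℂ) * (cexp (2 * Real.pi * I * (⟪ξ, u⟫ : ℂ)) *
        conj (cexp (2 * Real.pi * I * (⟪ξ, v⟫ : ℂ)))) =
      cexp (-(σ : ℂ) * (‖ξ‖ : ℂ) ^ 2 + 2 * Real.pi * I * (⟪u - v, ξ⟫ : ℂ)) := by
  rw [← phase_sub, Complex.ofReal_exp, ← Complex.exp_add, real_inner_comm ξ]
  congr 1
  push_cast
  ring

/-- **Gaussian Fourier pairing.** `∫ e^{-σ|ξ|²} e^{2πi⟨ξ,u⟩} conj e^{2πi⟨ξ,v⟩} dξ =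
(π/σ)^{3/2} e^{-π²|u-v|²/σ}`. [folklore] -/
theorem integral_gauss_phase {σ : ℝ} (hσ : 0 < σ) (u v : EuclideanSpace ℝ (Fin 3)) :
    ∫ ξ : EuclideanSpace ℝ (Fin 3), (Real.exp (-σ * ‖ξ‖ ^ 2) : ℂ) * (cexp (2 * Real.pi * I * (⟪ξ, u⟫ : ℂ)) *
        conj (cexp (2 * Real.pi * I * (⟪ξ, v⟫ : ℂ)))) =
      (((Real.pi / σ) ^ ((3 : ℝ) / 2) * Real.exp (-(Real.pi ^ 2 * ‖u - v‖ ^ 2 / σ)) : ℝ) : ℂ) := by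
  have h := GaussianFourier.integral_cexp_neg_mul_sq_norm_add (V := EuclideanSpace ℝ (Fin 3)) (b := (σ : ℂ))
    (by simpa using hσ) (2 * Real.pi * I) (u - v)
  rw [gaussConst_eq hσ] at h
  simp_rw [gauss_phase_eq]
  rw [h]
  have hσ0 : (σ : ℂ) ≠ 0 := by exact_mod_cast hσ.ne'
  push_cast
  congr 1
  congr 1
  rw [show (2 * (Real.pi : ℂ) * I) ^ 2 = -(4 * (Real.pi : ℂ) ^ 2) by
    rw [mul_pow, mul_pow, I_sq]; ring]
  field_simp

/-- The phase-weighted Gaussian is integrable. [folklore] -/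
theorem integrable_gauss_phase {σ : ℝ} (hσ : 0 < σ) (u v : EuclideanSpace ℝ (Fin 3)) :
    Integrable fun ξ : EuclideanSpace ℝ (Fin 3) => (Real.exp (-σ * ‖ξ‖ ^ 2) : ℂ) *
      (cexp (2 * Real.pi * I * (⟪ξ, u⟫ : ℂ)) * conj (cexp (2 * Real.pi * I * (⟪ξ, v⟫ : ℂ)))) := by
  simp_rw [gauss_phase_eq]
  exact GaussianFourier.integrable_cexp_neg_mul_sq_norm_add (by simpa using hσ) _ _

/-! ## Quadratic-form identities -/

/-- **Gaussian-weighted quadratic-form identity.**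
`∫ |∑ᵢ cᵢ e^{-σᵢ|ξ|²} e^{2πi⟨ξ,yᵢ⟩}|² dξ = ∑ᵢ∑ⱼ cᵢcⱼ (π/(σᵢ+σⱼ))^{3/2} e^{-π²|yᵢ-yⱼ|²/(σᵢ+σⱼ)}`.
[folklore] -/
theorem integral_normSq_gaussSum {ι : Type*} [Fintype ι] (c σ : ι → ℝ) (hσ : ∀ i, 0 < σ i)
    (y : ι → EuclideanSpace ℝ (Fin 3)) :
    ∫ ξ : EuclideanSpace ℝ (Fin 3), ‖∑ i, ((c i * Real.exp (-σ i * ‖ξ‖ ^ 2) : ℝ) : ℂ) *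
        cexp (2 * Real.pi * I * (⟪ξ, y i⟫ : ℂ))‖ ^ 2 =
      ∑ i, ∑ j, c i * c j * ((Real.pi / (σ i + σ j)) ^ ((3 : ℝ) / 2) *
        Real.exp (-(Real.pi ^ 2 * ‖y i - y j‖ ^ 2 / (σ i + σ j)))) := by
  -- the summands of the expanded square, and their integrals
  set g : ι → ι → EuclideanSpace ℝ (Fin 3) → ℂ := fun i j ξ => ((c i * c j : ℝ) : ℂ) *
    ((Real.exp (-(σ i + σ j) * ‖ξ‖ ^ 2) : ℂ) * (cexp (2 * Real.pi * I * (⟪ξ, y i⟫ : ℂ)) *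
      conj (cexp (2 * Real.pi * I * (⟪ξ, y j⟫ : ℂ))))) with hg
  have hgi : ∀ i j, Integrable (g i j) := fun i j =>
    (integrable_gauss_phase (add_pos (hσ i) (hσ j)) (y i) (y j)).const_mul _
  have hexp : ∀ ξ : EuclideanSpace ℝ (Fin 3), (((‖∑ i, ((c i * Real.exp (-σ i * ‖ξ‖ ^ 2) : ℝ) : ℂ) *
      cexp (2 * Real.pi * I * (⟪ξ, y i⟫ : ℂ))‖ ^ 2 : ℝ)) : ℂ) = ∑ i, ∑ j, g i j ξ := by
    intro ξ
    rw [← Complex.normSq_eq_norm_sq, ← Complex.mul_conj, map_sum, Finset.sum_mul_sum]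
    refine Finset.sum_congr rfl fun i _ => Finset.sum_congr rfl fun j _ => ?_
    simp only [hg, map_mul, Complex.conj_ofReal]
    push_cast
    rw [show -((σ i : ℂ) + σ j) * (‖ξ‖ : ℂ) ^ 2 = -(σ i : ℂ) * (‖ξ‖ : ℂ) ^ 2 +
      -(σ j : ℂ) * (‖ξ‖ : ℂ) ^ 2 by ring, Complex.exp_add]
    ring
  apply Complex.ofReal_injective
  rw [← integral_complex_ofReal]
  simp_rw [hexp]
  rw [integral_finsetSum _ fun i _ => integrable_finsetSum _ fun j _ => hgi i j]
  push_cast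
  refine Finset.sum_congr rfl fun i _ => ?_
  rw [integral_finsetSum _ fun j _ => hgi i j]
  refine Finset.sum_congr rfl fun j _ => ?_
  rw [hg, integral_const_mul, integral_gauss_phase (add_pos (hσ i) (hσ j))]
  push_cast
  ring

/-- **`L²`-norm of a finite Gaussian sum.**
`∫ (∑ᵢ cᵢ e^{-pᵢ|z-yᵢ|²})² dz = ∑ᵢ∑ⱼ cᵢcⱼ (π/(pᵢ+pⱼ))^{3/2} e^{-(pᵢpⱼ/(pᵢ+pⱼ))|yᵢ-yⱼ|²}`. [folklore] -/
theorem integral_sq_gaussSum {ι : Type*} [Fintype ι] (c p : ι → ℝ) (hp : ∀ i, 0 < p i)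
    (y : ι → EuclideanSpace ℝ (Fin 3)) :
    ∫ z : EuclideanSpace ℝ (Fin 3), (∑ i, c i * Real.exp (-p i * ‖z - y i‖ ^ 2)) ^ 2 =
      ∑ i, ∑ j, c i * c j * ((Real.pi / (p i + p j)) ^ ((3 : ℝ) / 2) *
        Real.exp (-(p i * p j / (p i + p j)) * ‖y i - y j‖ ^ 2)) := by
  have hgi : ∀ i j, Integrable fun z : EuclideanSpace ℝ (Fin 3) => c i * c j *
      (Real.exp (-p i * ‖z - y i‖ ^ 2) * Real.exp (-p j * ‖z - y j‖ ^ 2)) := fun i j =>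
    (integrable_gauss_mul_gauss (hp i) (hp j) (y i) (y j)).const_mul _
  have hexp : ∀ z : EuclideanSpace ℝ (Fin 3), (∑ i, c i * Real.exp (-p i * ‖z - y i‖ ^ 2)) ^ 2 =
      ∑ i, ∑ j, c i * c j *
        (Real.exp (-p i * ‖z - y i‖ ^ 2) * Real.exp (-p j * ‖z - y j‖ ^ 2)) := by
    intro z
    rw [sq, Finset.sum_mul_sum]
    exact Finset.sum_congr rfl fun i _ => Finset.sum_congr rfl fun j _ => by ring
  simp_rw [hexp]
  rw [integral_finsetSum _ fun i _ => integrable_finsetSum _ fun j _ => hgi i j]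
  refine Finset.sum_congr rfl fun i _ => ?_
  rw [integral_finsetSum _ fun j _ => hgi i j]
  refine Finset.sum_congr rfl fun j _ => ?_
  rw [integral_const_mul, integral_gauss_mul_gauss (hp i) (hp j)]

/-- The square of a finite Gaussian sum is integrable. [folklore] -/
theorem integrable_sq_gaussSum {ι : Type*} [Fintype ι] (c p : ι → ℝ) (hp : ∀ i, 0 < p i)
    (y : ι → EuclideanSpace ℝ (Fin 3)) :
    Integrable fun z : EuclideanSpace ℝ (Fin 3) => (∑ i, c i * Real.exp (-p i * ‖z - y i‖ ^ 2)) ^ 2 := by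
  have hexp : ∀ z : EuclideanSpace ℝ (Fin 3), (∑ i, c i * Real.exp (-p i * ‖z - y i‖ ^ 2)) ^ 2 =
      ∑ i, ∑ j, c i * c j *
        (Real.exp (-p i * ‖z - y i‖ ^ 2) * Real.exp (-p j * ‖z - y j‖ ^ 2)) := by
    intro z
    rw [sq, Finset.sum_mul_sum]
    exact Finset.sum_congr rfl fun i _ => Finset.sum_congr rfl fun j _ => by ring
  simp_rw [hexp]
  exact integrable_finsetSum _ fun i _ => integrable_finsetSum _ fun j _ =>
    (integrable_gauss_mul_gauss (hp i) (hp j) (y i) (y j)).const_mul _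

/-- **Plancherel for finite Gaussian sums.** With `G_s(v) = e^{-π|v|²/s²}` (so that
`𝓕G_s(ξ) = s³ e^{-π s²|ξ|²}`):
`∫ (∑ᵢ cᵢ G_{sᵢ}(z - yᵢ))² dz = ∫ |∑ᵢ cᵢ sᵢ³ e^{-π sᵢ²|ξ|²} e^{2πi⟨ξ,yᵢ⟩}|² dξ`. [folklore] -/
theorem integral_sq_gaussSum_eq_integral_normSq {ι : Type*} [Fintype ι] (c s : ι → ℝ)
    (hs : ∀ i, 0 < s i) (y : ι → EuclideanSpace ℝ (Fin 3)) :
    ∫ z : EuclideanSpace ℝ (Fin 3), (∑ i, c i * Real.exp (-(Real.pi / s i ^ 2) * ‖z - y i‖ ^ 2)) ^ 2 =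
      ∫ ξ : EuclideanSpace ℝ (Fin 3), ‖∑ i, ((c i * s i ^ 3 * Real.exp (-(Real.pi * s i ^ 2) * ‖ξ‖ ^ 2) : ℝ) : ℂ) *
        cexp (2 * Real.pi * I * (⟪ξ, y i⟫ : ℂ))‖ ^ 2 := by
  rw [integral_sq_gaussSum c _ (fun i => by have := hs i; positivity) y,
    integral_normSq_gaussSum _ _ (fun i => by have := hs i; positivity) y]
  refine Finset.sum_congr rfl fun i _ => Finset.sum_congr rfl fun j _ => ?_
  have hi := hs i
  have hj := hs j
  have hbase : Real.pi / (Real.pi / s i ^ 2 + Real.pi / s j ^ 2) =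
      (s i * s j) ^ 2 * (Real.pi / (Real.pi * s i ^ 2 + Real.pi * s j ^ 2)) := by
    field_simp
    ring
  have hrpow : (Real.pi / (Real.pi / s i ^ 2 + Real.pi / s j ^ 2)) ^ ((3 : ℝ) / 2) =
      (s i * s j) ^ 3 * (Real.pi / (Real.pi * s i ^ 2 + Real.pi * s j ^ 2)) ^ ((3 : ℝ) / 2) := by
    have h32 : ((s i * s j) ^ 2) ^ ((3 : ℝ) / 2) = (s i * s j) ^ 3 := by
      rw [← Real.rpow_natCast (s i * s j) 2, ← Real.rpow_mul (by positivity)]; norm_num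
    rw [hbase, Real.mul_rpow (by positivity) (by positivity), h32]
  have hexp : -(Real.pi / s i ^ 2 * (Real.pi / s j ^ 2) / (Real.pi / s i ^ 2 + Real.pi / s j ^ 2)) *
      ‖y i - y j‖ ^ 2 = -(Real.pi ^ 2 * ‖y i - y j‖ ^ 2 / (Real.pi * s i ^ 2 + Real.pi * s j ^ 2)) := by
    field_simp
    ring
  rw [hrpow, hexp]
  ring

/-! ## The two-scale kernel and its Fourier profile -/

/-- **`∫ F² = ∫ t² |S_N|²`.** [folklore] -/
theorem integral_kernelSum_sq {N : ℕ} (y : Fin N → EuclideanSpace ℝ (Fin 3)) {a b : ℝ} (ha : 0 < a) (hb : 0 < b) :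
    ∫ z : EuclideanSpace ℝ (Fin 3), (∑ k, (Real.exp (-(Real.pi / a ^ 2) * ‖z - y k‖ ^ 2) -
      (a / b) ^ 3 * Real.exp (-(Real.pi / b ^ 2) * ‖z - y k‖ ^ 2))) ^ 2 =
      ∫ ξ : EuclideanSpace ℝ (Fin 3), (a ^ 3 * Real.exp (-(Real.pi * a ^ 2) * ‖ξ‖ ^ 2) - a ^ 3 * Real.exp (-(Real.pi * b ^ 2) * ‖ξ‖ ^ 2)) ^ 2 * ‖∑ j, cexp (2 * Real.pi * I * (⟪ξ, y j⟫ : ℂ))‖ ^ 2 := by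
  have h := integral_sq_gaussSum_eq_integral_normSq (ι := Fin N ⊕ Fin N)
    (Sum.elim (fun _ => (1 : ℝ)) (fun _ => -(a / b) ^ 3)) (Sum.elim (fun _ => a) (fun _ => b))
    (fun i => by rcases i with i | i <;> simp [ha, hb]) (Sum.elim y y)
  have hL : ∀ z : EuclideanSpace ℝ (Fin 3), (∑ i : Fin N ⊕ Fin N, Sum.elim (fun _ => (1 : ℝ)) (fun _ => -(a / b) ^ 3) i *
      Real.exp (-(Real.pi / Sum.elim (fun _ => a) (fun _ => b) i ^ 2) *
        ‖z - Sum.elim y y i‖ ^ 2)) = (∑ k, (Real.exp (-(Real.pi / a ^ 2) * ‖z - y k‖ ^ 2) -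
      (a / b) ^ 3 * Real.exp (-(Real.pi / b ^ 2) * ‖z - y k‖ ^ 2))) := by
    intro z
    rw [Fintype.sum_sum_type, Finset.sum_sub_distrib]
    simp only [Sum.elim_inl, Sum.elim_inr, one_mul, neg_mul, Finset.sum_neg_distrib]
    ring
  have hR : ∀ ξ : EuclideanSpace ℝ (Fin 3), ‖∑ i : Fin N ⊕ Fin N,
      ((Sum.elim (fun _ => (1 : ℝ)) (fun _ => -(a / b) ^ 3) i *
        Sum.elim (fun _ => a) (fun _ => b) i ^ 3 *
        Real.exp (-(Real.pi * Sum.elim (fun _ => a) (fun _ => b) i ^ 2) * ‖ξ‖ ^ 2) : ℝ) : ℂ) *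
        cexp (2 * Real.pi * I * (⟪ξ, Sum.elim y y i⟫ : ℂ))‖ ^ 2 =
      (a ^ 3 * Real.exp (-(Real.pi * a ^ 2) * ‖ξ‖ ^ 2) - a ^ 3 * Real.exp (-(Real.pi * b ^ 2) * ‖ξ‖ ^ 2)) ^ 2 * ‖∑ j, cexp (2 * Real.pi * I * (⟪ξ, y j⟫ : ℂ))‖ ^ 2 := by
    intro ξ
    rw [Fintype.sum_sum_type]
    simp only [Sum.elim_inl, Sum.elim_inr, one_mul]
    rw [← Finset.mul_sum, ← Finset.mul_sum, ← add_mul, norm_mul, mul_pow, ← Complex.ofReal_add,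
      Complex.norm_real, Real.norm_eq_abs, sq_abs]
    congr 2
    field_simp
    ring
  simp_rw [hL, hR] at h
  exact h

/-- `F²` is integrable. [folklore] -/
theorem integrable_kernelSum_sq {N : ℕ} (y : Fin N → EuclideanSpace ℝ (Fin 3)) {a b : ℝ} (ha : 0 < a) (hb : 0 < b) :
    Integrable fun z : EuclideanSpace ℝ (Fin 3) => (∑ k, (Real.exp (-(Real.pi / a ^ 2) * ‖z - y k‖ ^ 2) -
      (a / b) ^ 3 * Real.exp (-(Real.pi / b ^ 2) * ‖z - y k‖ ^ 2))) ^ 2 := by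
  have h := integrable_sq_gaussSum (ι := Fin N ⊕ Fin N)
    (Sum.elim (fun _ => (1 : ℝ)) (fun _ => -(a / b) ^ 3))
    (Sum.elim (fun _ => Real.pi / a ^ 2) (fun _ => Real.pi / b ^ 2))
    (fun i => by rcases i with i | i <;> simp <;> positivity) (Sum.elim y y)
  refine h.congr (ae_of_all _ fun z => ?_)
  simp only
  rw [Fintype.sum_sum_type, Finset.sum_sub_distrib]
  simp only [Sum.elim_inl, Sum.elim_inr, one_mul, neg_mul, Finset.sum_neg_distrib]
  ring

/-! ## Splitting of the profile integral -/

/-- **Splitting of `∫ t² |S_N|²`.** If `t² ≤ h + c₁ e^{-π|ξ|²} + c₂ e^{-πa²|ξ|²}` pointwise with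
`h` continuous of compact support, then
`∫ t²|S_N|² ≤ ∫ h|S_N|² + c₁ ∫ e^{-π|ξ|²}|S_N|² + c₂ ∫ e^{-πa²|ξ|²}|S_N|²`. [folklore] -/
theorem integral_tprof_sf_le {N : ℕ} (y : Fin N → EuclideanSpace ℝ (Fin 3)) {a b : ℝ} (ha : 0 < a) {h : EuclideanSpace ℝ (Fin 3) → ℝ}
    (hhc : Continuous h) (hhs : HasCompactSupport h) {c₁ c₂ : ℝ}
    (hpt : ∀ ξ : EuclideanSpace ℝ (Fin 3), (a ^ 3 * Real.exp (-(Real.pi * a ^ 2) * ‖ξ‖ ^ 2) - a ^ 3 * Real.exp (-(Real.pi * b ^ 2) * ‖ξ‖ ^ 2)) ^ 2 ≤ h ξ + c₁ * Real.exp (-Real.pi * ‖ξ‖ ^ 2) +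
      c₂ * Real.exp (-(Real.pi * a ^ 2) * ‖ξ‖ ^ 2)) :
    ∫ ξ : EuclideanSpace ℝ (Fin 3), (a ^ 3 * Real.exp (-(Real.pi * a ^ 2) * ‖ξ‖ ^ 2) - a ^ 3 * Real.exp (-(Real.pi * b ^ 2) * ‖ξ‖ ^ 2)) ^ 2 * ‖∑ j, cexp (2 * Real.pi * I * (⟪ξ, y j⟫ : ℂ))‖ ^ 2 ≤
      (∫ ξ : EuclideanSpace ℝ (Fin 3), h ξ * ‖∑ j, cexp (2 * Real.pi * I * (⟪ξ, y j⟫ : ℂ))‖ ^ 2) +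
      c₁ * (∫ ξ : EuclideanSpace ℝ (Fin 3), Real.exp (-Real.pi * ‖ξ‖ ^ 2) *
        ‖∑ j, cexp (2 * Real.pi * I * (⟪ξ, y j⟫ : ℂ))‖ ^ 2) +
      c₂ * (∫ ξ : EuclideanSpace ℝ (Fin 3), Real.exp (-(Real.pi * a ^ 2) * ‖ξ‖ ^ 2) *
        ‖∑ j, cexp (2 * Real.pi * I * (⟪ξ, y j⟫ : ℂ))‖ ^ 2) := by
  have hI1 : Integrable fun ξ : EuclideanSpace ℝ (Fin 3) =>
      h ξ * ‖∑ j, cexp (2 * Real.pi * I * (⟪ξ, y j⟫ : ℂ))‖ ^ 2 :=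
    (hhc.mul (continuous_sf y)).integrable_of_hasCompactSupport hhs.mul_right
  have hIg : ∀ {σ : ℝ}, 0 < σ → Integrable fun ξ : EuclideanSpace ℝ (Fin 3) => Real.exp (-σ * ‖ξ‖ ^ 2) *
      ‖∑ j, cexp (2 * Real.pi * I * (⟪ξ, y j⟫ : ℂ))‖ ^ 2 := fun hσ =>
    (integrable_rexp_neg_mul_sq_norm hσ).mul_bdd (c := (N : ℝ) ^ 2)
      (continuous_sf y).aestronglyMeasurable (ae_of_all _ fun ξ => by
        rw [Real.norm_eq_abs, abs_of_nonneg (by positivity)]; exact sf_le y ξ)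
  have hI2 := hIg Real.pi_pos
  have hI3 := hIg (by positivity : 0 < Real.pi * a ^ 2)
  have hI12 : Integrable fun ξ : EuclideanSpace ℝ (Fin 3) =>
      h ξ * ‖∑ j, cexp (2 * Real.pi * I * (⟪ξ, y j⟫ : ℂ))‖ ^ 2 +
        c₁ * (Real.exp (-Real.pi * ‖ξ‖ ^ 2) *
          ‖∑ j, cexp (2 * Real.pi * I * (⟪ξ, y j⟫ : ℂ))‖ ^ 2) := hI1.add (hI2.const_mul c₁)
  have hI123 : Integrable fun ξ : EuclideanSpace ℝ (Fin 3) =>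
      h ξ * ‖∑ j, cexp (2 * Real.pi * I * (⟪ξ, y j⟫ : ℂ))‖ ^ 2 +
        c₁ * (Real.exp (-Real.pi * ‖ξ‖ ^ 2) *
          ‖∑ j, cexp (2 * Real.pi * I * (⟪ξ, y j⟫ : ℂ))‖ ^ 2) +
        c₂ * (Real.exp (-(Real.pi * a ^ 2) * ‖ξ‖ ^ 2) *
          ‖∑ j, cexp (2 * Real.pi * I * (⟪ξ, y j⟫ : ℂ))‖ ^ 2) := hI12.add (hI3.const_mul c₂)
  calc ∫ ξ : EuclideanSpace ℝ (Fin 3), (a ^ 3 * Real.exp (-(Real.pi * a ^ 2) * ‖ξ‖ ^ 2) - a ^ 3 * Real.exp (-(Real.pi * b ^ 2) * ‖ξ‖ ^ 2)) ^ 2 * ‖∑ j, cexp (2 * Real.pi * I * (⟪ξ, y j⟫ : ℂ))‖ ^ 2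
      ≤ ∫ ξ : EuclideanSpace ℝ (Fin 3), (h ξ * ‖∑ j, cexp (2 * Real.pi * I * (⟪ξ, y j⟫ : ℂ))‖ ^ 2 +
          c₁ * (Real.exp (-Real.pi * ‖ξ‖ ^ 2) *
            ‖∑ j, cexp (2 * Real.pi * I * (⟪ξ, y j⟫ : ℂ))‖ ^ 2)) +
          c₂ * (Real.exp (-(Real.pi * a ^ 2) * ‖ξ‖ ^ 2) *
            ‖∑ j, cexp (2 * Real.pi * I * (⟪ξ, y j⟫ : ℂ))‖ ^ 2) := by
        refine integral_mono_of_nonneg (ae_of_all _ fun ξ => by positivity) hI123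
          (ae_of_all _ fun ξ => ?_)
        have h0 : 0 ≤ ‖∑ j, cexp (2 * Real.pi * I * (⟪ξ, y j⟫ : ℂ))‖ ^ 2 := by positivity
        have := mul_le_mul_of_nonneg_right (hpt ξ) h0
        simp only
        linarith
    _ = _ := by
        rw [integral_add hI12 (hI3.const_mul c₂), integral_add hI1 (hI2.const_mul c₁),
          integral_const_mul, integral_const_mul]

end HcpRigidityDenseCentres

/-- **Registered helper stub of `stub_denseCentres` (Aux file 1): Plancherel for the two-scale
Gaussian kernel.** `∫ F² = ∫ t² |S_N|²` for `F(z) = ∑ₖ (e^{-π|z-yₖ|²/a²} − (a/b)³ e^{-π|z-yₖ|²/b²})`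
and `t = a³(e^{-πa²|ξ|²} − e^{-πb²|ξ|²})`. [folklore] -/
theorem stub_denseCentresPlancherel : ∀ (N : ℕ) (y : Fin N → EuclideanSpace ℝ (Fin 3)) (a b : ℝ), 0 < a → 0 < b → ∫ z : EuclideanSpace ℝ (Fin 3), (∑ k : Fin N, (Real.exp (-(Real.pi / a ^ 2) * ‖z - y k‖ ^ 2) - (a / b) ^ 3 * Real.exp (-(Real.pi / b ^ 2) * ‖z - y k‖ ^ 2))) ^ 2 = ∫ ξ : EuclideanSpace ℝ (Fin 3), (a ^ 3 * Real.exp (-(Real.pi * a ^ 2) * ‖ξ‖ ^ 2) - a ^ 3 * Real.exp (-(Real.pi * b ^ 2) * ‖ξ‖ ^ 2)) ^ 2 * ‖∑ j : Fin N, Complex.exp (2 * Real.pi * Complex.I * (inner ℝ ξ (y j) : ℂ))‖ ^ 2 :=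
  fun _ y _ _ ha hb => HcpRigidityDenseCentres.integral_kernelSum_sq y ha hb

end Summit.AtomisticToContinuum.Crystallization.Theorems

end
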